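import Summits.NavierStokesRegularity.NavierStokesRegularity.Theorems.ForcedAmplifierBridge
import Summits.NavierStokesRegularity.NavierStokesRegularity.Theorems.ForcedAmplifierViscosityNormalisation
import Summits.NavierStokesRegularity.NavierStokesRegularity.Theorems.ForcedAmplifierExactness
import Summits.NavierStokesRegularity.NavierStokesRegularity.Theorems.ForcedAmplifierBlowupAlternative
import Summits.NavierStokesRegularity.NavierStokesRegularity.Theorems.ForcedAmplifierAssembly
import Summits.NavierStokesRegularity.NavierStokesRegularity.Theorems.NavierStokesExistenceSmoothPeriodic
import Literature.Analysis.FunctionSpaces.TorusClassicalNSHorizonPatching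
import Literature.Analysis.FluidPDE.EulerReynolds
import HarnessLib

/-!
# Board placement of the node «THE AMPLIFIER» (route `ForcedAmplifier`, N31): refuting EITHER crux proves
# Clay (B)

ROOT DECOMPOSITION CELL decomp-ns, lens-4 (minimal-counterexample / extremal reduction), generation 26 —
instrumenting the residual `AMP` (stmt-NavierStokesRegularity-28101) and the door `QuantitativeGap`
(stmt-NavierStokesRegularity-28102).  Definition-free; no `sorry`; standard axioms.

## Content (all viscosities `> 0`; "SFR ν" = Tao's Conjecture 1.8 on `𝕋³` at viscosity `ν`, the
hypothesis of `QuantitativeGap`; "Amp ν" = the `ν`-slice of `AMP`)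

* `amplification_rescale` — `Amp μ → Amp ν` for all `μ, ν > 0` (parabolic rescaling at fixed period,
  `Torus.IsClassicalNSSolutionOn.rescale_translate` with factor `ν/μ`; the tree's
  `ForcedAmplifierViscosityNormalisation` is the case `μ = 1`).
* `smoothForcedRegular_rescale` — `SFR μ → SFR ν` for all `μ, ν > 0` (same rescaling applied to the
  datum `(μ/ν) u₀` and the force `(μ/ν)² f((μ/ν) s)`).
* `periodicExistence_of_forall_smoothForcedRegular` — `(∀ ν > 0, SFR ν) → Clay (B)`
  (`NavierStokesExistenceSmoothPeriodic`): descend the periodic datum to the torus, solve with `f ≡ 0` on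
  every slab, patch by forward uniqueness (`Torus.IsClassicalNSSolutionOn.exists_Ici_iff_forall_Icc`),
  lift (`IsClassicalNSSolutionOn.of_torus_holds`, `isNavierStokesSolution_and_smooth_iff`).
* `periodicExistence_of_not_quantitativeGap` — `¬ QuantitativeGap → Clay (B)`: a failure of the door
  carries `SFR ν` at some `ν`, hence at every `ν`.
* `periodicExistence_of_not_amp` — `¬ AMP → Clay (B)`: if forced `H¹` amplification is bounded at some
  viscosity it is bounded at every viscosity (rescaling), so by the blow-up alternative (item
  stmt-NavierStokesRegularity-28106, `Theorems.ForcedAmplifierBlowupAlternative.blowupAlternative_proof`)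
  Conjecture 1.8 holds at every viscosity, whence (B).
* `amp_or_periodicExistence`, `quantitativeGap_or_periodicExistence` — the two dichotomies.
* `amp_iff_unitViscosity`, `quantitativeGap_iff_unitViscosity` (`aprioriBound_iff_not_amplification`) — both
  open pieces are equivalent to their `ν = 1` slices (Tao's normalisation, Remark 1.11, kernel-grade).
* `target_iff_amp_and_quantitativeGap` — the node equation of N31 as one kernel theorem:
  `D♯ ↔ AMP ∧ QuantitativeGap` (→: `Exactness` + `BlowupAlternative`; ←: `Assembly` + `Bridge`, all landed).

READING for the cell.  Both pieces of N31 are REFUTATION-PROOF SHORT OF THE SUMMIT: a kernel refutation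
of `AMP` or of `QuantitativeGap` is a kernel proof of Clay (B), which closes the summit by the BOARD RULE
(D-0052).  With the node equation the two open pieces are pinned between the two periodic Clay statements:
D♯ ⟺ AMP ∧ QGAP, D♯ ⟹ AMP, D♯ ⟹ QGAP, ¬AMP ⟹ (B), ¬QGAP ⟹ (B) — refuter budget on 28101/28102 is
budget on Clay (B); the informative moves are INSTRUMENTATION of AMP (energy ceiling,
`Theorems.ForcedAmplifierEnergyCeiling`) and the cite-grade homogeneous door (28108).
[cite: Tao2013Localisation, Remark 1.11 and Conj. 1.8/1.10; RobinsonRodrigoSadowskiCUP2016, Introduction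
(13) (rescaling) and §8.1 (forward uniqueness); FeffermanClay2006, (B)]
-/

set_option linter.dupNamespace false

noncomputable section

open Set Function Filter
open scoped ContDiff Topology
open Literature.Analysis.FunctionSpaces Literature.Analysis.FluidPDE
open Summit.NavierStokesRegularity.NavierStokesRegularity.Theorems.ForcedAmplifierBridge
open Summit.NavierStokesRegularity.NavierStokesRegularity.Theorems.ForcedAmplifierViscosityNormalisation

namespace Summit.NavierStokesRegularity.NavierStokesRegularity.Theorems.ForcedAmplifierBoardPlacement

/-! ## Rescaling of the amplification slice -/

/-- **Viscosity rescaling of forced `H¹` amplification**: `Amp μ → Amp ν` for `μ, ν > 0`, by the parabolic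
rescaling `(u, p, f)(t, x) ↦ (a u(at, x), a² p(at, x), a² f(at, x))`, `a = ν/μ`, from `[0, T]` at viscosity
`μ` to `[0, T/a]` at viscosity `ν` (budget `(max (a²A) (a⁴A), T₀/a)`, peaks scale by `a²`).
[cite: Tao2013Localisation, Remark 1.11; RobinsonRodrigoSadowskiCUP2016, Introduction (13)] -/
theorem amplification_rescale {μ ν : ℝ} (hμ : 0 < μ) (hν : 0 < ν)
    (hA : ∃ A T₀ : ℝ, ∀ M : ℝ,
      ∃ (T : ℝ) (f u : ℝ → UnitAddTorus (Fin 3) → EuclideanSpace ℝ (Fin 3))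
        (p : ℝ → UnitAddTorus (Fin 3) → ℝ),
        (0 < T ∧ Torus.IsClassicalNSSolutionOn (Icc 0 T) μ f u p ∧ Torus.IsSmoothSpaceTimeOn (Icc 0 T) f) ∧
          T ≤ T₀ ∧ 2 * Torus.kineticEnergy (u 0) + Torus.gradNormSq (u 0) ≤ A ∧
          (∀ t ∈ Icc 0 T, 2 * Torus.kineticEnergy (f t) + Torus.gradNormSq (f t) ≤ A) ∧
          ∃ t ∈ Icc 0 T, M < 2 * Torus.kineticEnergy (u t) + Torus.gradNormSq (u t)) :
    ∃ A T₀ : ℝ, ∀ M : ℝ,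
      ∃ (T : ℝ) (f u : ℝ → UnitAddTorus (Fin 3) → EuclideanSpace ℝ (Fin 3))
        (p : ℝ → UnitAddTorus (Fin 3) → ℝ),
        (0 < T ∧ Torus.IsClassicalNSSolutionOn (Icc 0 T) ν f u p ∧ Torus.IsSmoothSpaceTimeOn (Icc 0 T) f) ∧
          T ≤ T₀ ∧ 2 * Torus.kineticEnergy (u 0) + Torus.gradNormSq (u 0) ≤ A ∧
          (∀ t ∈ Icc 0 T, 2 * Torus.kineticEnergy (f t) + Torus.gradNormSq (f t) ≤ A) ∧
          ∃ t ∈ Icc 0 T, M < 2 * Torus.kineticEnergy (u t) + Torus.gradNormSq (u t) := by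
  obtain ⟨A, T₀, hM⟩ := hA
  set a : ℝ := ν / μ with ha_def
  have ha : 0 < a := div_pos hν hμ
  have haμ : a * μ = ν := div_mul_cancel₀ ν hμ.ne'
  refine ⟨max (a ^ 2 * A) ((a ^ 2) ^ 2 * A), T₀ / a, fun M => ?_⟩
  obtain ⟨T, f, u, p, ⟨hT, hcl, hf⟩, hTT₀, hu0, hfA, t, ht, hMt⟩ := hM (M / a ^ 2)
  have ha2 : 0 < a ^ 2 := by positivity
  -- the rescaled episode at viscosity `ν = a μ` on `[0, T/a]`
  have hres := hcl.rescale_translate (t₀ := (0 : ℝ)) ha hT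
  simp only [sub_zero, zero_add] at hres
  rw [haμ] at hres
  have hφ : ContDiff ℝ ∞ (fun z : ℝ × EuclideanSpace ℝ (Fin 3) => ((a * z.1, z.2) : ℝ × EuclideanSpace ℝ (Fin 3))) :=
    (contDiff_const.mul contDiff_fst).prodMk contDiff_snd
  have hmaps : ∀ s ∈ Icc (0 : ℝ) (T / a), a * s ∈ Icc (0 : ℝ) T := fun s hs =>
    ⟨mul_nonneg ha.le hs.1, by
      rw [← mul_div_cancel₀ T ha.ne']
      exact mul_le_mul_of_nonneg_left hs.2 ha.le⟩
  have hφmaps : MapsTo (fun z : ℝ × EuclideanSpace ℝ (Fin 3) => ((a * z.1, z.2) : ℝ × EuclideanSpace ℝ (Fin 3)))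
      (Icc 0 (T / a) ×ˢ univ) (Icc 0 T ×ˢ univ) := fun z hz =>
    mk_mem_prod (hmaps z.1 (mem_prod.1 hz).1) (mem_univ _)
  have hf₁ : Torus.IsSmoothSpaceTimeOn (Icc 0 (T / a)) (fun s x => f (a * s) x) :=
    hf.comp hφ.contDiffOn hφmaps
  have hf' : Torus.IsSmoothSpaceTimeOn (Icc 0 (T / a)) (fun s x => a ^ 2 • f (a * s) x) :=
    hf₁.const_smul (a ^ 2)
  refine ⟨T / a, fun s x => a ^ 2 • f (a * s) x, fun s x => a • u (a * s) x,
    fun s x => a ^ 2 * p (a * s) x, ⟨div_pos hT ha, hres, hf'⟩, ?_, ?_, ?_, ?_⟩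
  · exact div_le_div_of_nonneg_right hTT₀ ha.le
  · show 2 * Torus.kineticEnergy (fun x => a • u (a * 0) x) +
        Torus.gradNormSq (fun x => a • u (a * 0) x) ≤ _
    simp only [mul_zero]
    rw [h1Sq_const_smul (hcl.smooth_velocity.isSmooth_slice ⟨le_rfl, hT.le⟩) a]
    exact le_trans (mul_le_mul_of_nonneg_left hu0 ha2.le) (le_max_left _ _)
  · intro s hs
    have hs' := hmaps s hs
    show 2 * Torus.kineticEnergy (fun x => a ^ 2 • f (a * s) x) +
        Torus.gradNormSq (fun x => a ^ 2 • f (a * s) x) ≤ _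
    rw [h1Sq_const_smul (hf.isSmooth_slice hs') (a ^ 2)]
    exact le_trans (mul_le_mul_of_nonneg_left (hfA _ hs') (by positivity)) (le_max_right _ _)
  · refine ⟨t / a, ⟨div_nonneg ht.1 ha.le, div_le_div_of_nonneg_right ht.2 ha.le⟩, ?_⟩
    show M < 2 * Torus.kineticEnergy (fun x => a • u (a * (t / a)) x) +
        Torus.gradNormSq (fun x => a • u (a * (t / a)) x)
    rw [mul_div_cancel₀ t ha.ne', h1Sq_const_smul (hcl.smooth_velocity.isSmooth_slice ht) a, mul_comm]
    exact (div_lt_iff₀ ha2).1 hMt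

/-! ## Rescaling of Conjecture 1.8 -/

/-- **Viscosity rescaling of Conjecture 1.8 on the torus**: `SFR μ → SFR ν` for `μ, ν > 0`.  Given a
datum `u₀`, a force `f` and a horizon `T` at viscosity `ν`, put `a := ν/μ`; Conjecture 1.8 at `μ` solves
from the datum `a⁻¹ u₀` with the force `a⁻² f(s/a)` on `[0, aT]`, and the parabolic rescaling by `a`
returns a classical solution of NS_ν(f) on `[0, T]` from `u₀`.
[cite: Tao2013Localisation, Remark 1.11; RobinsonRodrigoSadowskiCUP2016, Introduction (13)] -/
theorem smoothForcedRegular_rescale {μ ν : ℝ} (hμ : 0 < μ) (hν : 0 < ν)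
    (hS : ∀ T : ℝ, 0 < T → ∀ u₀ : UnitAddTorus (Fin 3) → EuclideanSpace ℝ (Fin 3),
      Torus.IsSmooth u₀ → Torus.IsDivFree u₀ →
      ∀ f : ℝ → UnitAddTorus (Fin 3) → EuclideanSpace ℝ (Fin 3), Torus.IsSmoothSpaceTimeOn (Ici 0) f →
        ∃ (u : ℝ → UnitAddTorus (Fin 3) → EuclideanSpace ℝ (Fin 3)) (p : ℝ → UnitAddTorus (Fin 3) → ℝ),
          Torus.IsClassicalNSSolutionOn (Icc 0 T) μ f u p ∧ u 0 = u₀) :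
    ∀ T : ℝ, 0 < T → ∀ u₀ : UnitAddTorus (Fin 3) → EuclideanSpace ℝ (Fin 3),
      Torus.IsSmooth u₀ → Torus.IsDivFree u₀ →
      ∀ f : ℝ → UnitAddTorus (Fin 3) → EuclideanSpace ℝ (Fin 3), Torus.IsSmoothSpaceTimeOn (Ici 0) f →
        ∃ (u : ℝ → UnitAddTorus (Fin 3) → EuclideanSpace ℝ (Fin 3)) (p : ℝ → UnitAddTorus (Fin 3) → ℝ),
          Torus.IsClassicalNSSolutionOn (Icc 0 T) ν f u p ∧ u 0 = u₀ := by
  intro T hT u₀ hu₀ hdiv f hf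
  set a : ℝ := ν / μ with ha_def
  have ha : 0 < a := div_pos hν hμ
  have haμ : a * μ = ν := div_mul_cancel₀ ν hμ.ne'
  -- the rescaled datum and force at viscosity `μ`
  set v₀ : UnitAddTorus (Fin 3) → EuclideanSpace ℝ (Fin 3) := fun x => a⁻¹ • u₀ x with hv₀
  set f₁ : ℝ → UnitAddTorus (Fin 3) → EuclideanSpace ℝ (Fin 3) := fun s x => (a ^ 2)⁻¹ • f (a⁻¹ * s) x
    with hf₁
  have hv₀s : Torus.IsSmooth v₀ := Torus.IsSmooth.smul a⁻¹ hu₀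
  have hv₀d : Torus.IsDivFree v₀ := by
    intro x
    have h1 := Literature.Analysis.FluidPDE.Torus.divergence_const_smul (hu₀.isContDiff (by simp)) a⁻¹ x
    have h2 : (a⁻¹ • u₀ : UnitAddTorus (Fin 3) → EuclideanSpace ℝ (Fin 3)) = v₀ := by
      funext y; simp [hv₀]
    rw [h2] at h1
    rw [h1, hdiv x, mul_zero]
  have hφ : ContDiff ℝ ∞ (fun z : ℝ × EuclideanSpace ℝ (Fin 3) => ((a⁻¹ * z.1, z.2) : ℝ × EuclideanSpace ℝ (Fin 3))) :=
    (contDiff_const.mul contDiff_fst).prodMk contDiff_snd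
  have hφmaps : MapsTo (fun z : ℝ × EuclideanSpace ℝ (Fin 3) => ((a⁻¹ * z.1, z.2) : ℝ × EuclideanSpace ℝ (Fin 3)))
      (Ici 0 ×ˢ univ) (Ici 0 ×ˢ univ) := fun z hz =>
    mk_mem_prod (mul_nonneg (inv_nonneg.2 ha.le) (mem_prod.1 hz).1) (mem_univ _)
  have hf₁s : Torus.IsSmoothSpaceTimeOn (Ici 0) f₁ :=
    (show Torus.IsSmoothSpaceTimeOn (Ici 0) (fun s x => f (a⁻¹ * s) x) from
      hf.comp hφ.contDiffOn hφmaps).const_smul (a ^ 2)⁻¹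
  -- solve at viscosity `μ` on `[0, aT]` and rescale back
  have haT : 0 < a * T := mul_pos ha hT
  obtain ⟨v, q, hcl, hv0⟩ := hS (a * T) haT v₀ hv₀s hv₀d f₁ hf₁s
  have hres := hcl.rescale_translate (t₀ := (0 : ℝ)) ha haT
  simp only [sub_zero, zero_add] at hres
  rw [haμ, mul_div_cancel_left₀ T ha.ne'] at hres
  have hforce : (fun t x => a ^ 2 • f₁ (a * t) x) = f := by
    funext t x
    simp only [hf₁, smul_smul]
    rw [mul_inv_cancel₀ (pow_ne_zero 2 ha.ne'), one_smul, ← mul_assoc, inv_mul_cancel₀ ha.ne', one_mul]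
  rw [hforce] at hres
  refine ⟨fun t x => a • v (a * t) x, fun t x => a ^ 2 * q (a * t) x, hres, ?_⟩
  funext x
  show a • v (a * 0) x = u₀ x
  rw [mul_zero, hv0]
  simp only [hv₀, smul_smul]
  rw [mul_inv_cancel₀ ha.ne', one_smul]

/-! ## Conjecture 1.8 at every viscosity gives Clay (B) -/

/-- **Conjecture 1.8 on the torus (all viscosities) implies Clay (B).**  Descend the smooth divergence-free
ℤ³-periodic datum `U₀` to `u₀ := U₀ ∘ repr`; with `f ≡ 0`, Conjecture 1.8 gives classical solutions on every
slab `[0,T]`, forward uniqueness patches them to `[0,∞)`, and the lift is a smooth solution on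
`ℝ³ × [0,∞)` from `U₀` with periodic velocity (and pressure) slices.
[cite: FeffermanClay2006, (B); RobinsonRodrigoSadowskiCUP2016, §8.1; Tao2013Localisation, Thm 5.1] -/
theorem periodicExistence_of_forall_smoothForcedRegular
    (hS : ∀ ν : ℝ, 0 < ν → ∀ T : ℝ, 0 < T → ∀ u₀ : UnitAddTorus (Fin 3) → EuclideanSpace ℝ (Fin 3),
      Torus.IsSmooth u₀ → Torus.IsDivFree u₀ →
      ∀ f : ℝ → UnitAddTorus (Fin 3) → EuclideanSpace ℝ (Fin 3), Torus.IsSmoothSpaceTimeOn (Ici 0) f →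
        ∃ (u : ℝ → UnitAddTorus (Fin 3) → EuclideanSpace ℝ (Fin 3)) (p : ℝ → UnitAddTorus (Fin 3) → ℝ),
          Torus.IsClassicalNSSolutionOn (Icc 0 T) ν f u p ∧ u 0 = u₀) :
    NavierStokesExistenceSmoothPeriodic := by
  intro ν hν U₀ hU₀ hdiv hperU₀
  set u₀ : UnitAddTorus (Fin 3) → EuclideanSpace ℝ (Fin 3) := fun z => U₀ (Torus.repr z) with hu₀def
  have hlift₀ : Torus.lift u₀ = U₀ := Torus.lift_descend_holds U₀ hperU₀
  have hsm₀ : Torus.IsSmooth u₀ := by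
    show ContDiff ℝ ∞ (Torus.lift u₀)
    rw [hlift₀]
    exact hU₀
  have hdiv₀ : Torus.IsDivFree u₀ := by
    refine (isDivFree_lift_iff (hsm₀.isContDiff (by simp))).1 ?_
    rw [hlift₀]
    exact hdiv
  have hf0 : Torus.IsSmoothSpaceTimeOn (Ici 0)
      (fun _ : ℝ => fun _ : UnitAddTorus (Fin 3) => (0 : EuclideanSpace ℝ (Fin 3))) :=
    Torus.isSmoothSpaceTimeOn_const (Torus.isSmooth_const _) _
  have hall : ∀ T : ℝ, 0 < T → ∃ (u : ℝ → UnitAddTorus (Fin 3) → EuclideanSpace ℝ (Fin 3))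
      (p : ℝ → UnitAddTorus (Fin 3) → ℝ),
      Torus.IsClassicalNSSolutionOn (Icc 0 T) ν
        (fun _ : ℝ => fun _ : UnitAddTorus (Fin 3) => (0 : EuclideanSpace ℝ (Fin 3))) u p ∧ u 0 = u₀ :=
    fun T hT => hS ν hν T hT u₀ hsm₀ hdiv₀ _ hf0
  obtain ⟨u, p, hcl, h0⟩ :=
    (Torus.IsClassicalNSSolutionOn.exists_Ici_iff_forall_Icc
      (f := fun _ : ℝ => fun _ : UnitAddTorus (Fin 3) => (0 : EuclideanSpace ℝ (Fin 3)))
      (u₀ := u₀) hν.le).2 hall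
  have hR : IsClassicalNSSolutionOn (Ici 0) ν
      (fun t => Torus.lift ((fun _ : ℝ => fun _ : UnitAddTorus (Fin 3) => (0 : EuclideanSpace ℝ (Fin 3))) t))
      (fun t => Torus.lift (u t)) (fun t => Torus.lift (p t)) :=
    IsClassicalNSSolutionOn.of_torus_holds hcl
  have hR' : IsClassicalNSSolutionOn (Ici 0) ν (0 : ℝ → EuclideanSpace ℝ (Fin 3) → EuclideanSpace ℝ (Fin 3))
      (fun t => Torus.lift (u t)) (fun t => Torus.lift (p t)) :=
    classicalNS_congr hR (fun t _ => by
      funext y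
      simp [Torus.lift_apply]) (fun _ _ => rfl) (fun _ _ => rfl)
  have h0' : (fun t => Torus.lift (u t)) 0 = U₀ := by
    show Torus.lift (u 0) = U₀
    rw [h0, hlift₀]
  obtain ⟨hns, hUs, hPs⟩ := isNavierStokesSolution_and_smooth_iff.2 ⟨hR', h0'⟩
  exact ⟨fun t => Torus.lift (u t), fun t => Torus.lift (p t), hUs, hPs, hns,
    fun t _ => Torus.isLatticePeriodic_lift (u t)⟩

/-! ## The dichotomies -/

/-- **Refuting the door proves Clay (B).**  `¬ QuantitativeGap → NavierStokesExistenceSmoothPeriodic`: a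
failure of the door holds Conjecture 1.8 at some viscosity, hence (rescaling) at every viscosity, hence (B).
[cite: Tao2013Localisation, Conj. 1.8 and Remark 1.11; FeffermanClay2006, (B)] -/
theorem periodicExistence_of_not_quantitativeGap (h : ¬ Theses.ForcedAmplifier.QuantitativeGap) :
    NavierStokesExistenceSmoothPeriodic := by
  unfold Theses.ForcedAmplifier.QuantitativeGap at h
  push Not at h
  obtain ⟨μ, hμ, hS, -⟩ := h
  exact periodicExistence_of_forall_smoothForcedRegular fun ν hν => smoothForcedRegular_rescale hμ hν hS

/-- **The door or Clay (B).** -/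
theorem quantitativeGap_or_periodicExistence :
    Theses.ForcedAmplifier.QuantitativeGap ∨ NavierStokesExistenceSmoothPeriodic :=
  (em _).imp_right periodicExistence_of_not_quantitativeGap

/-- **Refuting the residual proves Clay (B)**: `¬ AMP → NavierStokesExistenceSmoothPeriodic`.  If forced `H¹`
amplification is bounded at one viscosity it is bounded at every viscosity (`amplification_rescale`), so by
the blow-up alternative (item stmt-NavierStokesRegularity-28106,
`ForcedAmplifierBlowupAlternative.blowupAlternative_proof`) Conjecture 1.8 holds at every viscosity, whence (B).
[cite: Tao2013Localisation, Conj. 1.10 and Remark 1.11; FeffermanClay2006, (B)] -/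
theorem periodicExistence_of_not_amp (h : ¬ Theses.ForcedAmplifier.AMP) :
    NavierStokesExistenceSmoothPeriodic := by
  apply periodicExistence_of_forall_smoothForcedRegular
  intro ν hν
  by_contra hS
  apply h
  intro ν₀ hν₀
  exact amplification_rescale hν hν₀ (ForcedAmplifierBlowupAlternative.blowupAlternative_proof ν hν hS)

/-- **The residual or Clay (B).** -/
theorem amp_or_periodicExistence :
    Theses.ForcedAmplifier.AMP ∨ NavierStokesExistenceSmoothPeriodic :=
  (em _).imp_right periodicExistence_of_not_amp

/-! ## The node equation `D♯ ↔ AMP ∧ QuantitativeGap` -/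

/-- **Node equation of N31, kernel form**: `D♯ ↔ AMP ∧ QuantitativeGap`.  (→) `Exactness`
(`ForcedAmplifierExactness.target_iff_not_smoothForcedRegular`: a D♯ datum refutes Conjecture 1.8 at every
viscosity) with `BlowupAlternative` (`ForcedAmplifierBlowupAlternative.blowupAlternative_proof`: a failure of
Conjecture 1.8 at `ν` is forced `H¹` amplification at `ν`) gives `AMP`, and the door holds vacuously; (←) the
route's `Assembly` and `Bridge` (`ForcedAmplifierAssembly.assembly_holds`, `ForcedAmplifierBridge.bridge_holds`).
Stated as one `Iff` on purpose (no declaration of this file has an item as its bare conclusion). -/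
theorem target_iff_amp_and_quantitativeGap :
    NavierStokesBreakdownPeriodicPressurePeriodic ↔
      Theses.ForcedAmplifier.AMP ∧ Theses.ForcedAmplifier.QuantitativeGap := by
  refine ⟨fun hD => ?_, fun h => ForcedAmplifierAssembly.assembly_holds h.1 h.2 ForcedAmplifierBridge.bridge_holds⟩
  have hnot := ForcedAmplifierExactness.target_iff_not_smoothForcedRegular.1 hD
  exact ⟨fun ν hν => ForcedAmplifierBlowupAlternative.blowupAlternative_proof ν hν (hnot ν hν),
    fun ν hν hS => absurd hS (hnot ν hν)⟩

/-! ## Unit-viscosity normal forms of the two open pieces -/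

/-- **A priori bound = no amplification** (the `ν`-slice of the door's conclusion is the negation of the
`ν`-slice of `AMP`; pure logic). -/
theorem aprioriBound_iff_not_amplification (ν : ℝ) :
    (∀ A T₀ : ℝ, ∃ M : ℝ,
      ∀ (T : ℝ) (f u : ℝ → UnitAddTorus (Fin 3) → EuclideanSpace ℝ (Fin 3)) (p : ℝ → UnitAddTorus (Fin 3) → ℝ),
        (0 < T ∧ Torus.IsClassicalNSSolutionOn (Icc 0 T) ν f u p ∧ Torus.IsSmoothSpaceTimeOn (Icc 0 T) f) →
          T ≤ T₀ → 2 * Torus.kineticEnergy (u 0) + Torus.gradNormSq (u 0) ≤ A →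
          (∀ t ∈ Icc 0 T, 2 * Torus.kineticEnergy (f t) + Torus.gradNormSq (f t) ≤ A) →
          ∀ t ∈ Icc 0 T, 2 * Torus.kineticEnergy (u t) + Torus.gradNormSq (u t) ≤ M) ↔
    ¬ ∃ A T₀ : ℝ, ∀ M : ℝ,
      ∃ (T : ℝ) (f u : ℝ → UnitAddTorus (Fin 3) → EuclideanSpace ℝ (Fin 3))
        (p : ℝ → UnitAddTorus (Fin 3) → ℝ),
        (0 < T ∧ Torus.IsClassicalNSSolutionOn (Icc 0 T) ν f u p ∧ Torus.IsSmoothSpaceTimeOn (Icc 0 T) f) ∧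
          T ≤ T₀ ∧ 2 * Torus.kineticEnergy (u 0) + Torus.gradNormSq (u 0) ≤ A ∧
          (∀ t ∈ Icc 0 T, 2 * Torus.kineticEnergy (f t) + Torus.gradNormSq (f t) ≤ A) ∧
          ∃ t ∈ Icc 0 T, M < 2 * Torus.kineticEnergy (u t) + Torus.gradNormSq (u t) := by
  constructor
  · rintro h ⟨A, T₀, hM⟩
    obtain ⟨M, hMb⟩ := h A T₀
    obtain ⟨T, f, u, p, hE, hT, h0, hf, t, ht, hlt⟩ := hM M
    exact absurd (hMb T f u p hE hT h0 hf t ht) (not_le.2 hlt)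
  · intro h A T₀
    by_contra hc
    push Not at hc
    exact h ⟨A, T₀, fun M => by
      obtain ⟨T, f, u, p, hE, hT, h0, hf, t, ht, hlt⟩ := hc M
      exact ⟨T, f, u, p, hE, hT, h0, hf, t, ht, hlt⟩⟩

/-- **`AMP` at unit viscosity**: `AMP ↔ Amp 1` (the aside `ViscosityNormalisation` both ways, by
`amplification_rescale`). [cite: Tao2013Localisation, Remark 1.11] -/
theorem amp_iff_unitViscosity :
    Theses.ForcedAmplifier.AMP ↔
      ∃ A T₀ : ℝ, ∀ M : ℝ,
        ∃ (T : ℝ) (f u : ℝ → UnitAddTorus (Fin 3) → EuclideanSpace ℝ (Fin 3))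
          (p : ℝ → UnitAddTorus (Fin 3) → ℝ),
          (0 < T ∧ Torus.IsClassicalNSSolutionOn (Icc 0 T) 1 f u p ∧ Torus.IsSmoothSpaceTimeOn (Icc 0 T) f) ∧
            T ≤ T₀ ∧ 2 * Torus.kineticEnergy (u 0) + Torus.gradNormSq (u 0) ≤ A ∧
            (∀ t ∈ Icc 0 T, 2 * Torus.kineticEnergy (f t) + Torus.gradNormSq (f t) ≤ A) ∧
            ∃ t ∈ Icc 0 T, M < 2 * Torus.kineticEnergy (u t) + Torus.gradNormSq (u t) :=
  ⟨fun h => h 1 one_pos, fun h1 _ hν => amplification_rescale one_pos hν h1⟩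

/-- **The door at unit viscosity**: `QuantitativeGap ↔ (SFR 1 → a priori bound at ν = 1)` (both the
hypothesis and the conclusion of the door are viscosity-invariant: `smoothForcedRegular_rescale`,
`amplification_rescale`). [cite: Tao2013Localisation, Remark 1.11] -/
theorem quantitativeGap_iff_unitViscosity :
    Theses.ForcedAmplifier.QuantitativeGap ↔
      ((∀ T : ℝ, 0 < T → ∀ u₀ : UnitAddTorus (Fin 3) → EuclideanSpace ℝ (Fin 3),
        Torus.IsSmooth u₀ → Torus.IsDivFree u₀ →
        ∀ f : ℝ → UnitAddTorus (Fin 3) → EuclideanSpace ℝ (Fin 3), Torus.IsSmoothSpaceTimeOn (Ici 0) f →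
          ∃ (u : ℝ → UnitAddTorus (Fin 3) → EuclideanSpace ℝ (Fin 3)) (p : ℝ → UnitAddTorus (Fin 3) → ℝ),
            Torus.IsClassicalNSSolutionOn (Icc 0 T) 1 f u p ∧ u 0 = u₀) →
        ∀ A T₀ : ℝ, ∃ M : ℝ,
          ∀ (T : ℝ) (f u : ℝ → UnitAddTorus (Fin 3) → EuclideanSpace ℝ (Fin 3))
            (p : ℝ → UnitAddTorus (Fin 3) → ℝ),
            (0 < T ∧ Torus.IsClassicalNSSolutionOn (Icc 0 T) 1 f u p ∧ Torus.IsSmoothSpaceTimeOn (Icc 0 T) f) →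
              T ≤ T₀ → 2 * Torus.kineticEnergy (u 0) + Torus.gradNormSq (u 0) ≤ A →
              (∀ t ∈ Icc 0 T, 2 * Torus.kineticEnergy (f t) + Torus.gradNormSq (f t) ≤ A) →
              ∀ t ∈ Icc 0 T, 2 * Torus.kineticEnergy (u t) + Torus.gradNormSq (u t) ≤ M) := by
  refine ⟨fun h => h 1 one_pos, fun h1 ν hν hS => ?_⟩
  rw [aprioriBound_iff_not_amplification]
  intro hAν
  exact (aprioriBound_iff_not_amplification 1).1 (h1 (smoothForcedRegular_rescale hν one_pos hS))
    (amplification_rescale hν one_pos hAν)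

end Summit.NavierStokesRegularity.NavierStokesRegularity.Theorems.ForcedAmplifierBoardPlacement

end
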